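import Literature.AlgebraicGeometry.HodgeTheory.AbelianVarietyEndReducedIffMultiplicityFree
import HarnessLib

/-!
# Abelian varieties with COMMUTATIVE endomorphism ring are multiplicity-free: they have finitely many abelian
# subvarieties and reduced `End` (Mumford §19 Cor. 2: `M_n(D)` is non-commutative for `n ≥ 2`; Shimura §5.1 Prop. 1, 3–4)

Layer `Literature/AlgebraicGeometry/HodgeTheory`; theorems only (no `def`, no instance, no named fact; net debt 0).  §1 holds over
ANY field: a member `Y_q ∼ B^ι` of a family of abelian subvarieties `i_q : Y_q ↪ X` with `⨁ Y_q → X` an isogeny carries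
MATRIX UNITS — homomorphisms `a_l : X → B`, `b_k : B → X` with `b_k ≫ a_k = M • 𝟙_B` (`M ≠ 0`) and `b_k ≫ a_l = 0` for
`k ≠ l` — so two distinct indices give non-commuting endomorphisms `a_{k₀} ≫ b_{k₁}`, `a_{k₁} ≫ b_{k₀}` of `X`.  §2 draws the
consequences for isotypic components `Y_q ∼ B_q^{n_q+1}` (commutative `End X` ⟹ all `n_q = 0`, any field) and, over a
PERFECT field, for every `X` (`…SubvarietiesFiniteCriterion`, `…EndReducedIffMultiplicityFree`); the hypothesis may be
put on `End X` or on `End⁰(X) = ℚ ⊗ End X` (`End X ↪ End⁰ X`).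

THE PRINT.  Mumford, *Abelian Varieties* §19 Cor. 2 of Thm. 1 (p. 174): `End⁰(X) = ⊕_i M_{n_i}(D_i)`; a matrix algebra
`M_n(D)`, `n ≥ 2`, is not commutative, so a commutative `End⁰(X)` forces `n_i = 1` for all `i` — the situation of
Shimura, *Abelian Varieties with Complex Multiplication* §5.1 Prop. 1 and Prop. 3–4 (commutative semisimple subalgebras of
`End⁰`, CM abelian varieties: `X ∼ ∏ X_i` with pairwise non-isogenous simple CM factors when `End⁰` contains a field of
degree `2 dim X`).  With `…SubvarietiesFiniteCriterion` (Zarhin 2008 Thm. 3.2 = Lenstra–Oort–Zarhin) such `X` have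
finitely many abelian subvarieties.

Results (namespace `Literature.AlgebraicGeometry.HodgeTheory.AbelianVariety`):
* §1 (any field) **`exists_matrixUnits_of_component`** (`a_l`, `b_k`, `M` as above, the `b_k` finite),
  **`exists_comp_ne_comp_of_component`** (two distinct indices ⟹ non-commuting endomorphisms),
  `comm_end_of_comm_endAlgebra` (commutativity descends from `End⁰ X` to `End X`);
* §2 `forall_multiplicity_eq_zero_of_forall_comm` (any field, typed components), and over a perfect field
  **`finite_setOf_range_subvariety_of_forall_comm`** (every `X` with commutative `End X` has finitely many abelian
  subvarieties), `isReduced_end_of_forall_comm`, `exists_isIsogenous_biproduct_simple_of_forall_comm` (`X ∼ ⨁` of pairwise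
  non-isogenous simple abelian varieties), `finite_setOf_range_subvariety_of_forall_comm_endAlgebra` (hypothesis on `End⁰`).

## References
* [MumfordAV1970] D. Mumford, *Abelian Varieties* (1970), §19 Thm. 1, Cor. 1–2, Thm. 3 (pp. 173–176).
* [Shimura1998] G. Shimura, *Abelian Varieties with Complex Multiplication and Modular Functions* (1998), §5.1 Prop. 1,
  Prop. 3–4.
* [Zarhin2008HomomorphismsFiniteFields] Yu. G. Zarhin, *Homomorphisms of abelian varieties over finite fields* (2008)
  (arXiv:0711.1615), Thm. 3.2 (p. 7).
* [Milne1986AbelianVarieties] J. S. Milne, *Abelian Varieties*, in Cornell–Silverman (1986), §12 p. 122 (PDF p. 189).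
-/

noncomputable section

universe u

open CategoryTheory CategoryTheory.Limits

namespace Literature.AlgebraicGeometry.HodgeTheory

namespace AbelianVariety

open _root_.AlgebraicGeometry
open Literature.AlgebraicGeometry.Motives Literature.AlgebraicGeometry.Motives.AbelianVariety

variable {K : Type u} [Field K]

/-! ## §1 Matrix units from a repeated factor (any field) -/

section AnyField

variable {X : Motives.AbelianVariety K} {Q : Type} [Fintype Q] {Y : Q → Motives.AbelianVariety K}

/-- **MATRIX UNITS** (any field): for a member `Y_q ∼ B^ι` of a family of abelian subvarieties `i_q : Y_q ↪ X` whose addition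
map is an isogeny there are `a_l : X → B`, FINITE `b_k : B → X` and `M ≠ 0` with `b_k ≫ a_k = M • 𝟙_B` and `b_k ≫ a_l = 0`
for `k ≠ l` (`a_l = v ≫ π_q ≫ e ≫ π_l`, `b_k = ι_k ≫ w ≫ i_q` for quasi-inverses `v` of `⨁ Y → X` and `w` of `e : Y_q → B^ι`).
[cite: MumfordAV1970, §19 Cor. 2 of Thm. 1 (p. 174: `End⁰(A_i^{n_i}) = M_{n_i}(End⁰ A_i)`) and Remark p. 169]
[cite: Milne1986AbelianVarieties, §12 p. 122 (PDF p. 189)] -/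
theorem exists_matrixUnits_of_component (i : ∀ q, Y q ⟶ X) (hi : ∀ q, IsClosedImmersion (Hom.toSchemeHom (i q)))
    (hdesc : IsIsogeny (biproduct.desc i)) {q : Q} {B : Motives.AbelianVariety K} {ι : Type} [Fintype ι]
    (hY : IsIsogenous (Y q) (⨁ fun _ : ι ↦ B)) :
    ∃ (a : ι → (X ⟶ B)) (b : ι → (B ⟶ X)) (M : ℕ), M ≠ 0 ∧ (∀ k, IsFinite (Hom.toSchemeHom (b k))) ∧
      (∀ k, b k ≫ a k = M • 𝟙 B) ∧ ∀ k l, k ≠ l → b k ≫ a l = 0 := by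
  classical
  obtain ⟨v, m, hm, hdv, -⟩ := IsIsogeny.exists_nsmul_inverse_holds hdesc
  obtain ⟨e, he⟩ := hY
  obtain ⟨w, N, hN, -, hwe⟩ := IsIsogeny.exists_nsmul_inverse_holds he
  have h1 : ∀ {W : Motives.AbelianVariety K} (f : Y q ⟶ W), i q ≫ v ≫ biproduct.π Y q ≫ f = m • f := fun f ↦ by
    rw [← Category.assoc v, ← Category.assoc (i q), comp_quasiInverse_π_self i hdv q, Preadditive.nsmul_comp,
      Category.id_comp]
  have h2 : ∀ {W : Motives.AbelianVariety K} (f : (⨁ fun _ : ι ↦ B) ⟶ W), w ≫ e ≫ f = N • f := fun f ↦ by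
    rw [← Category.assoc, hwe, Preadditive.nsmul_comp, Category.id_comp]
  have key : ∀ k l : ι, (biproduct.ι (fun _ : ι ↦ B) k ≫ w ≫ i q) ≫
      (v ≫ biproduct.π Y q ≫ e ≫ biproduct.π (fun _ : ι ↦ B) l) =
        (m * N) • (biproduct.ι (fun _ : ι ↦ B) k ≫ biproduct.π (fun _ : ι ↦ B) l) := fun k l ↦ by
    simp only [Category.assoc]
    rw [h1, Preadditive.comp_nsmul, Preadditive.comp_nsmul, h2, Preadditive.comp_nsmul, smul_smul]
  refine ⟨fun l ↦ v ≫ biproduct.π Y q ≫ e ≫ biproduct.π (fun _ : ι ↦ B) l,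
    fun k ↦ biproduct.ι (fun _ : ι ↦ B) k ≫ w ≫ i q, m * N, Nat.mul_ne_zero hm.ne' hN.ne', fun k ↦ ?_, fun k ↦ ?_,
    fun k l hkl ↦ ?_⟩
  · haveI := isFinite_toSchemeHom_biproduct_ι (fun _ : ι ↦ B) k
    haveI : IsFinite (Hom.toSchemeHom w) := isFinite_of_comp_eq_nsmul_id hN.ne' hwe
    haveI := hi q
    haveI : IsFinite (Hom.toSchemeHom (w ≫ i q)) := isFinite_toSchemeHom_comp _ _
    exact isFinite_toSchemeHom_comp _ _
  · rw [key k k, biproduct.ι_π_self]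
  · rw [key k l, biproduct.ι_π_ne _ hkl, smul_zero]

/-- **TWO DISTINCT INDICES GIVE NON-COMMUTING ENDOMORPHISMS** (any field, `0 < dim B`): `φ = a_{k₀} ≫ b_{k₁}` and
`ψ = a_{k₁} ≫ b_{k₀}` satisfy `φ ≫ ψ = M • a_{k₀} ≫ b_{k₀} ≠ M • a_{k₁} ≫ b_{k₁} = ψ ≫ φ` (precompose with `b_{k₀}`).
[cite: MumfordAV1970, §19 Cor. 2 of Thm. 1 (p. 174: `M_n(D)`, `n ≥ 2`, is not commutative)] [cite: Shimura1998, §5.1 Prop. 3–4] -/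
theorem exists_comp_ne_comp_of_component (i : ∀ q, Y q ⟶ X) (hi : ∀ q, IsClosedImmersion (Hom.toSchemeHom (i q)))
    (hdesc : IsIsogeny (biproduct.desc i)) {q : Q} {B : Motives.AbelianVariety K} {ι : Type} [Fintype ι]
    (hY : IsIsogenous (Y q) (⨁ fun _ : ι ↦ B)) {k₀ k₁ : ι} (hk : k₀ ≠ k₁) (hB : 0 < B.dim) :
    ∃ φ ψ : X ⟶ X, φ ≫ ψ ≠ ψ ≫ φ := by
  obtain ⟨a, b, M, hM, hbf, hdiag, hoff⟩ := exists_matrixUnits_of_component i hi hdesc hY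
  refine ⟨a k₀ ≫ b k₁, a k₁ ≫ b k₀, fun h ↦ ?_⟩
  have h' := congrArg (fun χ ↦ b k₀ ≫ χ) h
  simp only [Category.assoc] at h'
  rw [← Category.assoc (b k₁) (a k₁), hdiag k₁, ← Category.assoc (b k₀) (a k₀), hdiag k₀,
    ← Category.assoc (b k₀) (a k₁), hoff k₀ k₁ hk, zero_comp] at h'
  simp only [Preadditive.nsmul_comp, Category.id_comp, smul_smul] at h'
  haveI := hbf k₀
  exact ne_zero_of_isFinite (b k₀) hB (hom_eq_zero_of_nsmul_eq_zero (Nat.mul_ne_zero hM hM) h')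

/-- Commutativity of `End⁰(X) = ℚ ⊗ End X` implies commutativity of `End X` (`End X ↪ End⁰ X`, `Hom` torsion-free).
[cite: MumfordAV1970, §19 Thm. 3 (p. 176) and Cor. 2 of Thm. 1 (p. 174)] -/
theorem comm_end_of_comm_endAlgebra (hcomm : ∀ x y : X.endAlgebra, x * y = y * x) (φ ψ : X ⟶ X) :
    φ ≫ ψ = ψ ≫ φ := by
  have hinj : Function.Injective (endAlgebra.of X) :=
    endAlgebra.of_injective_of_isIsogeny_zsmul_id (isIsogeny_zsmul_id_holds X)
  have h : endAlgebra.of X (End.of ψ * End.of φ) = endAlgebra.of X (End.of φ * End.of ψ) := by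
    rw [map_mul, map_mul, hcomm]
  have h' := hinj h
  rwa [End.mul_def, End.mul_def] at h'

end AnyField

/-! ## §2 Commutative `End X`: multiplicity-free, finitely many abelian subvarieties, reduced -/

section Components

variable {Q : Type} [Fintype Q] {B : Q → Motives.AbelianVariety K} {n : Q → ℕ} {X : Motives.AbelianVariety K}
  {Y : Q → Motives.AbelianVariety K}

/-- **COMMUTATIVE `End X` ⟹ MULTIPLICITY-FREE** (any field; components `Y_q ∼ B_q^{n_q+1}`, `0 < dim B_q`): every `n_q = 0`.
[cite: MumfordAV1970, §19 Cor. 2 of Thm. 1 (p. 174)] [cite: Shimura1998, §5.1 Prop. 3–4] -/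
theorem forall_multiplicity_eq_zero_of_forall_comm (hY : ∀ q, IsIsogenous (Y q) (⨁ fun _ : Fin (n q + 1) ↦ B q))
    (i : ∀ q, Y q ⟶ X) (hi : ∀ q, IsClosedImmersion (Hom.toSchemeHom (i q))) (hdesc : IsIsogeny (biproduct.desc i))
    (hB0 : ∀ q, 0 < (B q).dim) (hcomm : ∀ φ ψ : X ⟶ X, φ ≫ ψ = ψ ≫ φ) (q : Q) : n q = 0 := by
  by_contra hq
  obtain ⟨φ, ψ, hne⟩ := exists_comp_ne_comp_of_component i hi hdesc (hY q)
    (k₀ := (⟨0, by omega⟩ : Fin (n q + 1))) (k₁ := (⟨1, by omega⟩ : Fin (n q + 1))) (Fin.ne_of_val_ne (by norm_num))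
    (hB0 q)
  exact hne (hcomm φ ψ)

variable [PerfectField K]

/-- **AN ABELIAN VARIETY WITH COMMUTATIVE ENDOMORPHISM RING HAS FINITELY MANY ABELIAN SUBVARIETIES** (perfect field).
[cite: MumfordAV1970, §19 Cor. 1–2 of Thm. 1 (pp. 173–174)] [cite: Zarhin2008HomomorphismsFiniteFields, Thm. 3.2 (p. 7)]
[cite: Shimura1998, §5.1 Prop. 3–4] -/
theorem finite_setOf_range_subvariety_of_forall_comm (X : Motives.AbelianVariety K)
    (hcomm : ∀ φ ψ : X ⟶ X, φ ≫ ψ = ψ ≫ φ) :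
    {R : Set X.X.left | ∃ (Z : Motives.AbelianVariety K) (j : Z ⟶ X),
        IsClosedImmersion (Hom.toSchemeHom j) ∧ R = Set.range (Hom.toSchemeHom j)}.Finite := by
  obtain ⟨r, B, n, Y, i, hB, hB0, hni, hi, hY, -, hdesc, -⟩ := exists_isotypicComponents_orthogonal X
  exact (finite_setOf_range_subvariety_iff_forall_multiplicity_eq_zero hB hB0 hni hY i hi hdesc).2
    (forall_multiplicity_eq_zero_of_forall_comm hY i hi hdesc hB0 hcomm)

/-- Commutative `End X` is reduced (perfect field). [cite: MumfordAV1970, §19 Cor. 2 of Thm. 1 (p. 174)] -/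
theorem isReduced_end_of_forall_comm (X : Motives.AbelianVariety K) (hcomm : ∀ φ ψ : X ⟶ X, φ ≫ ψ = ψ ≫ φ) :
    _root_.IsReduced (End X) :=
  (finite_setOf_range_subvariety_iff_isReduced_end X).1 (finite_setOf_range_subvariety_of_forall_comm X hcomm)

/-- **Commutative `End X` ⟹ `X ∼ ⨁_{q < r} B_q` with pairwise non-isogenous simple `B_q` of positive dimension**
(perfect field). [cite: MumfordAV1970, §19 Cor. 1–2 of Thm. 1 (pp. 173–174)] [cite: Shimura1998, §5.1 Prop. 3–4] -/
theorem exists_isIsogenous_biproduct_simple_of_forall_comm (X : Motives.AbelianVariety K)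
    (hcomm : ∀ φ ψ : X ⟶ X, φ ≫ ψ = ψ ≫ φ) :
    ∃ (r : ℕ) (B : Fin r → Motives.AbelianVariety K), (∀ q, (B q).IsSimple) ∧ (∀ q, 0 < (B q).dim) ∧
      (∀ q q', q ≠ q' → ¬ IsIsogenous (B q) (B q')) ∧ IsIsogenous X (⨁ B) :=
  (finite_setOf_range_subvariety_iff_exists_isIsogenous_biproduct_simple X).1
    (finite_setOf_range_subvariety_of_forall_comm X hcomm)

/-- The same with the hypothesis on the endomorphism ALGEBRA `End⁰(X)`: **an abelian variety whose endomorphism algebra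
is commutative (e.g. a field) has finitely many abelian subvarieties** (perfect field). [cite: Shimura1998, §5.1 Prop. 1 and Prop. 3–4]
[cite: MumfordAV1970, §19 Cor. 2 of Thm. 1 (p. 174)] [cite: Zarhin2008HomomorphismsFiniteFields, Thm. 3.2 (p. 7)] -/
theorem finite_setOf_range_subvariety_of_forall_comm_endAlgebra (X : Motives.AbelianVariety K)
    (hcomm : ∀ x y : X.endAlgebra, x * y = y * x) :
    {R : Set X.X.left | ∃ (Z : Motives.AbelianVariety K) (j : Z ⟶ X),
        IsClosedImmersion (Hom.toSchemeHom j) ∧ R = Set.range (Hom.toSchemeHom j)}.Finite :=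
  finite_setOf_range_subvariety_of_forall_comm X (comm_end_of_comm_endAlgebra hcomm)

end Components

end AbelianVariety

end Literature.AlgebraicGeometry.HodgeTheory

end
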